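import Summits.Schanuel.Schanuel.Theorems.RootDecomp1BResFrame02

/-!
# RootDecomp1BResFrame — lens 4, generation 45 «RESULTANT CLEARING: t(1, ρ) = 5 IN EVERY DEGREE» (lane (d) of B-R26/B-R31 (ii); CHECKLIST B-g41 L2128 taken up verbatim, CLAIM L2306, ACK L2307, NODE ≈L2316–L2319; critic VERDICT pending at staging — filed only on GO) — continuation (RootDecomp1BResFrame03): §E THE ENGINE

(lens-4 g45 HOME kernel K = HOME/decomp-schanuel-lens-4/g45/ResFrame.lean 9524d315…, 978 l, imports tree `…RootDecomp1BAlgFrame09` + `…RootDecomp1KHyper47`; P ResFrameProbe.lean, C ResFrameCtrl.lean (rc 1 = 17 planted), NODE-g45.md. Port by census-1 gen 19 as `RootDecomp1BResFrame01–04`: 01 = §D the class `AlgUltraLiouvilleIrr` (β ≠ ρ, f irreducible over ℚ, unbounded degree, rate exp(−exp(A^m))) + `algUltraLiouville_sqrt_two` + §A plumbing (first-variable splitting `finSuccEquiv` over ℤ) + §B column-wise Leibniz bounds / Sylvester matrix (`resultant_bounds_cols`); 02 = §E0 the resultant `resX0` eliminating X₀ (`aeval_resX0`, `resX0_ne_zero`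 via `aeval_eq_zero_of_conj_irrQ`, `resX0_bounds`) + §R growth (`kappa1`, `royC_le_exp`, `endgame₄₀`, `Gamma`); 03 = §E THE ENGINE `algebraicIndependent_cons_of_algUltraIrr (hRoy : Roy2014_thm_1_1) (hρ : AlgUltraLiouvilleIrr ρ) : AlgebraicIndependent ℚ (ρ, e, e^ρ, e^i, e^{iρ})` (scoped `maxHeartbeats 1600000` as in K); 04 = §C cells `five_le_polarDeg_one_of_algUltraIrr (hRoy) (hρ) : ((5 : ℕ) : Cardinal) ≤ polarDeg ![(1 : ℝ), ρ]`, swap, surplus/KleinPolar bodies, the four At-cells + §M the named member: `irreducible_fSeq_map`, `algUltraLiouvilleIrr_rhoA` HYP-FREE, `five_le_polarDeg_one_rhoA (hRoy)`, `rhoA_position_irr` — mod `Roy2014_thm_1_1` ONLY (registered, unproved ⇒ binder stays).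
PORT EDITS: the class def's docstring tagged «[class] definition …»; three generic helpers private (`mem_roots_map_iff` — known dedup twin —, `ringHom_mvaeval_int`, `coeff_map_algebraMap_mv`) with per-part private copies; four one-line docstrings added; linter option dropped; statements and proofs verbatim. `--supports stmt-Schanuel-24622`; no census credit carried; rung 0 — nothing here proves Schanuel.)
-/

noncomputable section

open Complex IntermediateField MvPolynomial

namespace Summit.Schanuel.Schanuel.Theorems.RootDecomp1BResFrame

open Summit.Schanuel.Schanuel.Theorems.RootDecomp1EPointTransfer (Roy2014_thm_1_1)
open Summit.Schanuel.Schanuel.Theorems.RootDecomp1KHyper (mvlen mvlen_nonneg abs_coeff_le_mvlen one_le_mvlen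
  exists_ball_eval_ne_zero mvlen_add_le mvlen_mul_le mvlen_C_mul_le mvlen_sum_le mvlen_prod_le mvlen_C mvlen_zero)
open Summit.Schanuel.Schanuel.Theorems.RootDecomp1BHyperFrame (royS framePt Ff Ff_eq_aeval exists_lipschitz_Ff gcoef
  gcoef_ne_zero apply_zero_le_totalDegree linearIndependent_one_irrational)
open Summit.Schanuel.Schanuel.Theorems.RootDecomp1BQuadFrame (qy qe qpt qpt_apply framePt_qy_qe linearIndependent_qpt
  QuadHyperLiouville norm_exp_qpt_le)
open Summit.Schanuel.Schanuel.Theorems.RootDecomp1BAlgFrame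
open Summit.Schanuel.Schanuel.Theorems.RootDecomp1BFedFlagCore (KleinIH polarDeg polarField)
open Summit.Schanuel.Schanuel.Theorems.RootDecomp1BDefectFloorDefs (SharpRelativeLindemannAt TameDefectZeroAt
  WildSharpDefectZeroAt WildSharpDefectZeroInitAt WildSharpInitAt)
open Summit.Schanuel.Schanuel.Theorems.RootDecomp1BDefectFloorCells (natCast_le_trdeg_of_algebraicIndependent)
open Summit.Schanuel.Schanuel.Theorems.RootDecomp1BRadicalDescent (exists_int_relation norm_mvaeval_le_mvlen)
open Summit.Schanuel.Schanuel.Theorems.RootDecomp1BMovingZero (mem_polarField_one mem_polarField_swap)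

/-- Membership in the root multiset of `f` over `ℂ`. -/
private theorem mem_roots_map_iff {f : Polynomial ℤ} (hf : f ≠ 0) (r : ℂ) :
    r ∈ (f.map (algebraMap ℤ ℂ)).roots ↔ Polynomial.aeval r f = 0 := by
  have hfC0 : f.map (algebraMap ℤ ℂ) ≠ 0 := (Polynomial.map_ne_zero_iff (algebraMap ℤ ℂ).injective_int).mpr hf
  rw [Polynomial.mem_roots hfC0, Polynomial.IsRoot.def, Polynomial.eval_map, ← Polynomial.aeval_def]

/-! ## §E  THE ENGINE: resultant clearing at growing degree against Roy's frame measure -/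

section Engine

/-- `exp(−x) < δ` once `x > δ⁻¹` (`δ > 0`). -/
private theorem exp_neg_lt_of_inv_lt_RF {δ x : ℝ} (hδ : 0 < δ) (hx : δ⁻¹ < x) : Real.exp (-x) < δ := by
  rw [Real.exp_neg, inv_lt_comm₀ (Real.exp_pos _) hδ]
  linarith [Real.add_one_le_exp x]

/-- **THE ENGINE CONSTANT `Γ(D, L, K_ℓ, R₁)`** (CHECKLIST B-g41 (3): ONE `def`, inputs listed) — `D = deg P` (total
degree of the integer relation `P(ρ, e, e^ρ, e^i, e^{iρ}) = 0`), `L = len P`, `K_ℓ` = the local Lipschitz constant of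
`F(x) = P(x, e, e^x, e^i, e^{ix})` at `ρ` (tree `exists_lipschitz_Ff`), `R₁ = |ρ| + 1` (so the conjugates `γ` of the
approximant have `|γ| ≤ (A+1)` and `|e^{γ}|, |e^{iγ}| ≤ e^{(A+1)}`… entering through `Θ`), `κ₁` = `kappa1` of `royC_le_exp`:
`Γ = κ₁ (D+1)^{40} + (D+1)^2 + 2 log L + 3D + K_ℓ + D R₁ + 2`.  The engine runs the class at level
`m = 41 + k + m₁ + 2` with `2^k > Γ` (`endgame₄₀`: `Γ·A^{40} < A^m`) and `m₁ > δ₁⁻¹ + δ⁻¹ + 1` (`δ₁` the Lipschitz radius,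
`δ` the punctured-ball radius of the grouped coefficient, tree `exists_ball_eval_ne_zero`) — so that `A ≥ m` forces
`exp(−exp(A^m)) < min(δ₁, δ)`. -/
def Gamma (D : ℕ) (L Kl R₁ : ℝ) : ℝ :=
  kappa1 * ((D : ℝ) + 1) ^ 40 + ((D : ℝ) + 1) ^ 2 + 2 * Real.log L + 3 * D + Kl + D * R₁ + 2

/-- `x^k ≤ exp (k x)` for `x ≥ 0`. -/
private theorem pow_le_exp_mul_RF {x : ℝ} (hx : 0 ≤ x) (k : ℕ) : x ^ k ≤ Real.exp (k * x) := by
  rw [Real.exp_nat_mul]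
  exact pow_le_pow_left₀ hx (by linarith [Real.add_one_le_exp x]) k

/-- `x ≤ exp x`. -/
private theorem le_exp_self_RF (x : ℝ) : x ≤ Real.exp x := by linarith [Real.add_one_le_exp x]

/-- Norm of a product over a multiset with factors of norm `≤ b`. -/
private theorem norm_multiset_prod_map_le_RF (s : Multiset ℂ) (g : ℂ → ℂ) {b : ℝ} (hb : 0 ≤ b)
    (h : ∀ r ∈ s, ‖g r‖ ≤ b) : ‖(s.map g).prod‖ ≤ b ^ Multiset.card s := by
  induction s using Multiset.induction_on with
  | empty => simp
  | cons a s ih =>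
    rw [Multiset.map_cons, Multiset.prod_cons, Multiset.card_cons, pow_succ, norm_mul, mul_comm]
    exact mul_le_mul (ih fun r hr => h r (Multiset.mem_cons_of_mem hr)) (h a (Multiset.mem_cons_self a s))
      (norm_nonneg _) (pow_nonneg hb _)

set_option maxHeartbeats 1600000 in
/-- **THE ENGINE (resultant frame, every degree).**  `Roy2014_thm_1_1` and `ρ ∈ AlgUltraLiouvilleIrr` make
`ρ, e, e^{ρ}, e^{i}, e^{iρ}` algebraically independent over ℚ.  Shape: an integer relation `P(ρ, e^{α_ρ}) = 0`;
at a level-`m` approximant `β` (root of the ℚ-irreducible `f`, `d = deg f ≤ A`, height `≤ A`) the RESULTANT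
`N = Res_{X₀}(f, P) ∈ ℤ[X₁..X₄]` is non-zero (`resX0_ne_zero`), of degree `≤ dD` and length `≤ (d+D₀)! L^d A^{D₀}`
(`resX0_bounds`), and `|N(e^{α_β})| ≤ A^{D₀}·|F(β)|·(L Θ^D)^{A}` with `|F(β)| ≤ Kl·exp(−exp(A^m))` (Lipschitz,
`F(ρ) = 0`), `Θ = (A+1)e^{R₁}` (house of the conjugates) — against Roy's floor
`exp(−royC(dD)·e^{A^8}·(1 + log len N))` with `royC(dD) ≤ exp(κ₁ ((D+1)A)^{40})`; the whole comparison collapses to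
`A^m ≤ Γ·A^{40}` with `Γ = Gamma D L K_ℓ R₁` (ONE def, above), refuted by `endgame₄₀` at `m ≥ 41 + k`, `2^k > Γ`. -/
theorem algebraicIndependent_cons_of_algUltraIrr (hRoy : Roy2014_thm_1_1) {ρ : ℝ}
    (hρ : AlgUltraLiouvilleIrr ρ) :
    AlgebraicIndependent ℚ (Fin.cons (ρ : ℂ) (fun j => cexp (qpt ρ j)) : Fin (4 + 1) → ℂ) := by
  classical
  by_contra hdep
  obtain ⟨P, hP0, hPρ⟩ := exists_int_relation hdep
  have hFρ : Ff P qy qe ρ = 0 := by rw [Ff_eq_aeval, framePt_qy_qe]; exact hPρ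
  obtain ⟨Kl, δ₁, hKl, hδ₁, hlip⟩ := exists_lipschitz_Ff P qy qe ρ
  -- the nonvanishing radius of the grouped coefficient
  obtain ⟨s₀, hs₀⟩ := MvPolynomial.ne_zero_iff.mp hP0
  have hs₀' : s₀ ∈ P.support := MvPolynomial.mem_support_iff.mpr hs₀
  obtain ⟨g, hg⟩ : ∃ g : Polynomial ℂ, g = (gcoef P (Finsupp.tail s₀)).map (Int.castRingHom ℂ) :=
    ⟨_, rfl⟩
  have hg0 : g ≠ 0 := by
    rw [hg]
    exact (Polynomial.map_ne_zero_iff (Int.castRingHom ℂ).injective_int).mpr (gcoef_ne_zero P hs₀')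
  obtain ⟨δ, hδ, hball⟩ := exists_ball_eval_ne_zero g hg0 ρ
  -- the integer constants of the relation
  obtain ⟨D, hDP⟩ : ∃ D : ℕ, D = P.totalDegree := ⟨_, rfl⟩
  obtain ⟨Dx, hDx⟩ : ∃ Dx : ℕ, Dx = (finSuccEquiv ℤ 4 P).natDegree := ⟨_, rfl⟩
  have hDxD : Dx ≤ D := by rw [hDx, hDP]; exact natDegree_finSuccEquiv_le P
  -- the real constants (independent of the approximant)
  obtain ⟨L, hL⟩ : ∃ L : ℝ, L = ((mvlen P : ℤ) : ℝ) := ⟨_, rfl⟩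
  have hL1 : 1 ≤ L := by rw [hL]; exact_mod_cast one_le_mvlen hP0
  have hL0 : 0 < L := lt_of_lt_of_le zero_lt_one hL1
  have hlogL : 0 ≤ Real.log L := Real.log_nonneg hL1
  obtain ⟨R₁, hR₁⟩ : ∃ R₁ : ℝ, R₁ = |ρ| + 1 := ⟨_, rfl⟩
  have hR₁1 : 1 ≤ R₁ := by rw [hR₁]; linarith [abs_nonneg ρ]
  have hR₁0 : 0 ≤ R₁ := le_trans zero_le_one hR₁1
  have hD0 : (0 : ℝ) ≤ D := Nat.cast_nonneg _
  obtain ⟨D₁, hD₁⟩ : ∃ D₁ : ℝ, D₁ = (D : ℝ) + 1 := ⟨_, rfl⟩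
  have hD₁1 : 1 ≤ D₁ := by rw [hD₁]; linarith
  have hD₁0 : 0 ≤ D₁ := le_trans zero_le_one hD₁1
  -- `c = Γ(D, L, K_ℓ, R₁)` (`Gamma`), displayed with the atom `D₁ = D + 1`
  obtain ⟨c, hc⟩ : ∃ c : ℝ, c = kappa1 * D₁ ^ 40 + D₁ ^ 2 + 2 * Real.log L +
      3 * D + Kl + D * R₁ + 2 := ⟨Gamma D L Kl R₁, by rw [hD₁]; rfl⟩
  obtain ⟨k, hk⟩ : ∃ k : ℕ, c < 2 ^ k := pow_unbounded_of_one_lt c one_lt_two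
  obtain ⟨m₁, hm₁⟩ : ∃ m₁ : ℕ, δ₁⁻¹ + δ⁻¹ + 1 < m₁ := exists_nat_gt _
  obtain ⟨m, hm⟩ : ∃ m : ℕ, m = 41 + k + m₁ + 2 := ⟨_, rfl⟩
  -- the approximant
  obtain ⟨β, f, A, hmA, hirr, hfirr, hfdeg, hfA, hfβ, hne, hlt⟩ := hρ m
  have hf0 : f ≠ 0 := fun hf => hfirr.ne_zero (by rw [hf, Polynomial.map_zero])
  have hb2 : 2 ≤ A := le_trans (by omega) hmA
  have hA1 : (1 : ℝ) ≤ A := by exact_mod_cast le_trans one_le_two hb2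
  have hA0 : (0 : ℝ) ≤ A := le_trans zero_le_one hA1
  have hdA : (f.natDegree : ℝ) ≤ A := by exact_mod_cast hfdeg
  -- smallness at level `m`
  have hbm : (m₁ : ℝ) ≤ Real.exp ((A : ℝ) ^ m) := by
    have h1 : (m₁ : ℝ) ≤ A := by exact_mod_cast le_trans (by omega) hmA
    exact (h1.trans (le_self_pow₀ hA1 (by omega))).trans (le_exp_self_RF _)
  have hsmall : |ρ - β| < Real.exp (-(m₁ : ℝ)) :=
    hlt.trans_le (Real.exp_le_exp.mpr (neg_le_neg hbm))
  have hδinv : 0 < δ⁻¹ := inv_pos.mpr hδ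
  have hδ₁inv : 0 < δ₁⁻¹ := inv_pos.mpr hδ₁
  have hdist₁ : |β - ρ| < δ₁ := by
    rw [abs_sub_comm]; exact hsmall.trans (exp_neg_lt_of_inv_lt_RF hδ₁ (by linarith))
  have hdist : |β - ρ| < δ := by
    rw [abs_sub_comm]; exact hsmall.trans (exp_neg_lt_of_inv_lt_RF hδ (by linarith))
  have hdist1 : |ρ - β| < 1 := hsmall.trans_le (Real.exp_le_one_iff.mpr (by simp))
  have hβabs : |β| ≤ R₁ := by
    have h := abs_sub_abs_le_abs_sub β ρ
    rw [abs_sub_comm] at hdist1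
    rw [hR₁]; linarith
  -- the point and its size
  obtain ⟨θ, hθ⟩ : ∃ θ : Fin 4 → ℂ, θ = fun j => cexp (qpt β j) := ⟨_, rfl⟩
  have hθM : ∀ j, ‖θ j‖ ≤ Real.exp R₁ := fun j => by rw [hθ]; exact norm_exp_qpt_le hβabs hR₁1 j
  have hM1 : 1 ≤ Real.exp R₁ := by linarith [Real.add_one_le_exp R₁]
  obtain ⟨Θ, hΘ⟩ : ∃ Θ : ℝ, Θ = ((A : ℝ) + 1) * Real.exp R₁ := ⟨_, rfl⟩
  have hΘ1 : 1 ≤ Θ := by rw [hΘ]; exact one_le_mul_of_one_le_of_one_le (by linarith only [hA0]) hM1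
  have hΘ0 : 0 ≤ Θ := le_trans zero_le_one hΘ1
  -- the complex data of `f`
  set fC : Polynomial ℂ := f.map (algebraMap ℤ ℂ) with hfC
  have hβC : Polynomial.aeval ((β : ℝ) : ℂ) f = 0 := by rw [aeval_ofReal_int, hfβ]; simp
  have hβroot : ((β : ℝ) : ℂ) ∈ fC.roots := (mem_roots_map_iff hf0 _).mpr hβC
  have hcard : Multiset.card fC.roots ≤ A :=
    (Polynomial.card_roots' fC).trans ((Polynomial.natDegree_map_le).trans hfdeg)
  have hlead : ‖fC.leadingCoeff‖ ≤ A := by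
    rw [hfC, Polynomial.leadingCoeff_map_of_injective (algebraMap ℤ ℂ).injective_int, algebraMap_int_eq,
      eq_intCast, Complex.norm_intCast]
    exact_mod_cast hfA f.natDegree
  -- THE CLEARED RELATION `N`
  obtain ⟨N, hN⟩ : ∃ N : MvPolynomial (Fin 4) ℤ, N = resX0 f P := ⟨_, rfl⟩
  have hN0 : N ≠ 0 := by
    rw [hN]
    refine resX0_ne_zero hfirr hβC P (s₀' := Finsupp.tail s₀) ?_
    rw [← hg]; exact hball β hne hdist
  obtain ⟨hNlen, hNdeg⟩ := resX0_bounds f P hfA (n := 4)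
  rw [← hN, ← hDx] at hNlen
  rw [← hN, ← hDP] at hNdeg
  -- its height `H = len N ≥ 1`
  obtain ⟨H, hH⟩ : ∃ H : ℕ, H = (mvlen N).toNat := ⟨_, rfl⟩
  have hHZ : (H : ℤ) = mvlen N := by rw [hH]; exact Int.toNat_of_nonneg (mvlen_nonneg N)
  have hH1 : 1 ≤ H := by
    have h : (1 : ℤ) ≤ (H : ℤ) := by rw [hHZ]; exact one_le_mvlen hN0
    exact_mod_cast h
  have hHpos : (0 : ℝ) < H := by exact_mod_cast lt_of_lt_of_le zero_lt_one hH1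
  have hcoef : ∀ s, |N.coeff s| ≤ (H : ℤ) := fun s => by rw [hHZ]; exact abs_coeff_le_mvlen _ s
  -- THE FLOOR (Roy, degree `d·D`)
  have hlow := algFrameMeasure_explicit_of_roy hRoy (f.natDegree * D) β f A hirr hf0 hfdeg hfA hfβ N hN0
    hNdeg H hH1 hcoef
  rw [← hθ] at hlow
  -- THE UPPER BOUND via the product formula, the root `β` split off
  have hprodf : aeval θ N = fC.leadingCoeff ^ Dx *
      (fC.roots.map fun γ => aeval (Fin.cons γ θ : Fin (4 + 1) → ℂ) P).prod := by
    rw [hN, aeval_resX0, ← hDx]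
  have hβfac : aeval (Fin.cons ((β : ℝ) : ℂ) θ : Fin (4 + 1) → ℂ) P = Ff P qy qe β := by
    rw [Ff_eq_aeval, framePt_qy_qe, hθ]
  have hFβ : ‖Ff P qy qe β‖ ≤ Kl * Real.exp (-Real.exp ((A : ℝ) ^ m)) := by
    have h1 := hlip β hdist₁
    rw [hFρ, sub_zero] at h1
    exact h1.trans (mul_le_mul_of_nonneg_left (by rw [abs_sub_comm]; exact hlt.le) hKl)
  have hconj : ∀ γ ∈ fC.roots.erase ((β : ℝ) : ℂ),
      ‖aeval (Fin.cons γ θ : Fin (4 + 1) → ℂ) P‖ ≤ L * Θ ^ D := by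
    intro γ hγ
    have hγf : Polynomial.aeval γ f = 0 := (mem_roots_map_iff hf0 γ).mp (Multiset.mem_of_mem_erase hγ)
    have hγn : ‖γ‖ ≤ A + 1 := norm_root_le hf0 hfA hγf
    have hcoord : ∀ i, ‖(Fin.cons γ θ : Fin (4 + 1) → ℂ) i‖ ≤ Θ := by
      intro i
      refine Fin.cases ?_ (fun j => ?_) i
      · rw [Fin.cons_zero, hΘ]
        calc ‖γ‖ ≤ (A : ℝ) + 1 := hγn
          _ = ((A : ℝ) + 1) * 1 := (mul_one _).symm
          _ ≤ ((A : ℝ) + 1) * Real.exp R₁ := mul_le_mul_of_nonneg_left hM1 (by positivity)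
      · rw [Fin.cons_succ, hΘ]
        calc ‖θ j‖ ≤ Real.exp R₁ := hθM j
          _ = 1 * Real.exp R₁ := (one_mul _).symm
          _ ≤ ((A : ℝ) + 1) * Real.exp R₁ := mul_le_mul_of_nonneg_right (by linarith only [hA0]) (Real.exp_pos _).le
    have h := norm_mvaeval_le_mvlen P (Fin.cons γ θ : Fin (4 + 1) → ℂ) hΘ1 hcoord
    rw [← hDP] at h
    rw [hL]; exact h
  have hX1 : 1 ≤ L * Θ ^ D := one_le_mul_of_one_le_of_one_le hL1 (one_le_pow₀ hΘ1)
  have hup : ‖aeval θ N‖ ≤ (A : ℝ) ^ Dx * ((Kl * Real.exp (-Real.exp ((A : ℝ) ^ m))) * (L * Θ ^ D) ^ A) := by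
    rw [hprodf, norm_mul, norm_pow, ← Multiset.cons_erase hβroot, Multiset.map_cons, Multiset.prod_cons, norm_mul,
      hβfac]
    have h3 : ‖((fC.roots.erase ((β : ℝ) : ℂ)).map fun γ => aeval (Fin.cons γ θ : Fin (4 + 1) → ℂ) P).prod‖ ≤
        (L * Θ ^ D) ^ Multiset.card (fC.roots.erase ((β : ℝ) : ℂ)) :=
      norm_multiset_prod_map_le_RF _ _ (by positivity) hconj
    have h4 : (L * Θ ^ D) ^ Multiset.card (fC.roots.erase ((β : ℝ) : ℂ)) ≤ (L * Θ ^ D) ^ A :=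
      pow_le_pow_right₀ hX1 ((Multiset.card_erase_le).trans hcard)
    exact mul_le_mul (pow_le_pow_left₀ (norm_nonneg _) hlead Dx)
      (mul_le_mul hFβ (h3.trans h4) (norm_nonneg _) (by positivity)) (by positivity) (by positivity)
  -- everything in exponential form: the upper bound
  obtain ⟨U, hU⟩ : ∃ U : ℝ, U = D * A + Kl + A * Real.log L + D * (A : ℝ) ^ 2 + D * R₁ * A := ⟨_, rfl⟩
  have hupexp : (A : ℝ) ^ Dx * ((Kl * Real.exp (-Real.exp ((A : ℝ) ^ m))) * (L * Θ ^ D) ^ A) ≤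
      Real.exp (U - Real.exp ((A : ℝ) ^ m)) := by
    have e1 : (A : ℝ) ^ Dx ≤ Real.exp (D * A) :=
      (pow_le_exp_mul_RF hA0 Dx).trans (Real.exp_le_exp.mpr (mul_le_mul_of_nonneg_right
        (by exact_mod_cast hDxD) hA0))
    have e2 : Kl ≤ Real.exp Kl := le_exp_self_RF Kl
    have e3 : Θ ≤ Real.exp (A + R₁) := by
      rw [hΘ, Real.exp_add]
      exact mul_le_mul_of_nonneg_right (Real.add_one_le_exp _) (Real.exp_pos _).le
    have e4 : Θ ^ D ≤ Real.exp (D * (A + R₁)) := by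
      rw [Real.exp_nat_mul]; exact pow_le_pow_left₀ hΘ0 e3 D
    have e5 : L * Θ ^ D ≤ Real.exp (Real.log L + D * (A + R₁)) := by
      rw [Real.exp_add, Real.exp_log hL0]; exact mul_le_mul_of_nonneg_left e4 hL0.le
    have e6 : (L * Θ ^ D) ^ A ≤ Real.exp (A * (Real.log L + D * (A + R₁))) := by
      rw [Real.exp_nat_mul]; exact pow_le_pow_left₀ (by positivity) e5 A
    calc (A : ℝ) ^ Dx * ((Kl * Real.exp (-Real.exp ((A : ℝ) ^ m))) * (L * Θ ^ D) ^ A)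
        ≤ Real.exp (D * A) * ((Real.exp Kl * Real.exp (-Real.exp ((A : ℝ) ^ m))) *
            Real.exp (A * (Real.log L + D * (A + R₁)))) :=
          mul_le_mul e1 (mul_le_mul (mul_le_mul_of_nonneg_right e2 (Real.exp_pos _).le) e6 (by positivity)
            (by positivity)) (by positivity) (Real.exp_pos _).le
      _ = Real.exp (U - Real.exp ((A : ℝ) ^ m)) := by
          simp only [← Real.exp_add]
          congr 1
          rw [hU]; ring
  -- everything in exponential form: the floor
  have hlogH : Real.log H ≤ ((A : ℝ) + D) * ((A : ℝ) + D) + A * Real.log L + D * A := by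
    have hHR : (H : ℝ) ≤ (Nat.factorial (f.natDegree + Dx) : ℝ) * (L ^ f.natDegree * (A : ℝ) ^ Dx) := by
      have h1 : ((H : ℤ) : ℝ) ≤ (((Nat.factorial (f.natDegree + Dx) : ℤ) *
          (mvlen P ^ f.natDegree * (A : ℤ) ^ Dx) : ℤ) : ℝ) := by
        exact_mod_cast (show (H : ℤ) ≤ _ from hHZ ▸ hNlen)
      rw [hL]; push_cast at h1 ⊢; exact h1
    have hfac : (Nat.factorial (f.natDegree + Dx) : ℝ) ≤ Real.exp (((A : ℝ) + D) * ((A : ℝ) + D)) := by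
      have h1 : (Nat.factorial (f.natDegree + Dx) : ℝ) ≤ ((f.natDegree + Dx : ℕ) : ℝ) ^ (f.natDegree + Dx) := by
        exact_mod_cast Nat.factorial_le_pow (f.natDegree + Dx)
      have hle : ((f.natDegree + Dx : ℕ) : ℝ) ≤ (A : ℝ) + D := by
        push_cast; exact add_le_add hdA (by exact_mod_cast hDxD)
      have hnn : (0 : ℝ) ≤ ((f.natDegree + Dx : ℕ) : ℝ) := Nat.cast_nonneg _
      have h2 : ((f.natDegree + Dx : ℕ) : ℝ) ^ (f.natDegree + Dx) ≤ ((A : ℝ) + D) ^ (f.natDegree + Dx) :=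
        pow_le_pow_left₀ hnn hle _
      have h3 : ((A : ℝ) + D) ^ (f.natDegree + Dx) ≤ ((A : ℝ) + D) ^ (A + D) :=
        pow_le_pow_right₀ (by linarith) (add_le_add hfdeg hDxD)
      have h4 : ((A : ℝ) + D) ^ (A + D) ≤ Real.exp (((A + D : ℕ) : ℝ) * ((A : ℝ) + D)) :=
        pow_le_exp_mul_RF (by positivity) (A + D)
      have h5 : ((A + D : ℕ) : ℝ) * ((A : ℝ) + D) = ((A : ℝ) + D) * ((A : ℝ) + D) := by push_cast; ring
      rw [h5] at h4
      exact h1.trans (h2.trans (h3.trans h4))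
    have hLd : L ^ f.natDegree ≤ Real.exp (A * Real.log L) := by
      have h1 : L ^ f.natDegree ≤ L ^ A := pow_le_pow_right₀ hL1 hfdeg
      have h2 : L ^ A = Real.exp (A * Real.log L) := by rw [Real.exp_nat_mul, Real.exp_log hL0]
      rw [← h2]; exact h1
    have hADx : (A : ℝ) ^ Dx ≤ Real.exp (D * A) :=
      (pow_le_exp_mul_RF hA0 Dx).trans (Real.exp_le_exp.mpr (mul_le_mul_of_nonneg_right
        (by exact_mod_cast hDxD) hA0))
    have hHexp : (H : ℝ) ≤ Real.exp (((A : ℝ) + D) * ((A : ℝ) + D) + A * Real.log L + D * A) := by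
      have h := hHR.trans (mul_le_mul hfac (mul_le_mul hLd hADx (by positivity) (Real.exp_pos _).le)
        (by positivity) (Real.exp_pos _).le)
      rw [← Real.exp_add, ← Real.exp_add, ← add_assoc] at h
      exact h
    exact (Real.log_le_iff_le_exp hHpos).mpr hHexp
  have hlogH0 : 0 ≤ Real.log H := Real.log_nonneg (by exact_mod_cast hH1)
  obtain ⟨W, hW⟩ : ∃ W : ℝ, W = kappa1 * ((D₁ * A) ^ 40) + (A : ℝ) ^ 8 +
      (((A : ℝ) + D) * ((A : ℝ) + D) + A * Real.log L + D * A) := ⟨_, rfl⟩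
  have hroyC : royC (f.natDegree * D) ≤ Real.exp (kappa1 * ((D₁ * A) ^ 40)) := by
    refine (royC_le_exp _).trans (Real.exp_le_exp.mpr (mul_le_mul_of_nonneg_left ?_ kappa1_nonneg))
    refine pow_le_pow_left₀ (by positivity) ?_ 40
    push_cast
    rw [hD₁]
    nlinarith [mul_le_mul_of_nonneg_right hdA hD0]
  have hfloorexp : Real.exp (-Real.exp W) ≤
      Real.exp (-(royC (f.natDegree * D) * Real.exp ((A : ℝ) ^ 8) * (1 + Real.log H))) := by
    rw [Real.exp_le_exp, neg_le_neg_iff, hW, Real.exp_add, Real.exp_add]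
    have h1 : 1 + Real.log H ≤ Real.exp (((A : ℝ) + D) * ((A : ℝ) + D) + A * Real.log L + D * A) := by
      refine le_trans ?_ (Real.add_one_le_exp _)
      linarith only [hlogH]
    exact mul_le_mul (mul_le_mul_of_nonneg_right hroyC (Real.exp_pos _).le) h1 (by linarith only [hlogH0])
      (by positivity)
  -- the chain and the exponent comparison
  have hchain : Real.exp (-Real.exp W) ≤ Real.exp (U - Real.exp ((A : ℝ) ^ m)) :=
    hfloorexp.trans (hlow.trans (hup.trans hupexp))
  rw [Real.exp_le_exp] at hchain
  have hAlogL : 0 ≤ (A : ℝ) * Real.log L := mul_nonneg hA0 hlogL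
  have hU0 : 0 ≤ U := by
    have h1 : 0 ≤ (D : ℝ) * A := mul_nonneg hD0 hA0
    have h2 : 0 ≤ (D : ℝ) * (A : ℝ) ^ 2 := by positivity
    have h3 : 0 ≤ (D : ℝ) * R₁ * A := by positivity
    rw [hU]; linarith only [h1, h2, h3, hKl, hAlogL]
  have hW0 : 0 ≤ W := by
    have h1 : 0 ≤ ((A : ℝ) + D) * ((A : ℝ) + D) := mul_self_nonneg _
    have h2 : 0 ≤ kappa1 * ((D₁ * A) ^ 40) := mul_nonneg kappa1_nonneg (by positivity)
    have h3 : 0 ≤ (A : ℝ) ^ 8 := by positivity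
    have h4 : 0 ≤ (D : ℝ) * A := mul_nonneg hD0 hA0
    rw [hW]; linarith only [h1, h2, h3, h4, hAlogL]
  have hAm : Real.exp ((A : ℝ) ^ m) < Real.exp (U + W + 1) := by
    have h1 : Real.exp ((A : ℝ) ^ m) ≤ U + Real.exp W := by linarith only [hchain]
    have h2 : U + Real.exp W < Real.exp U + Real.exp W := by
      linarith only [Real.add_one_le_exp U]
    have h3 : Real.exp U ≤ Real.exp (U + W) := Real.exp_le_exp.mpr (by linarith only [hW0])
    have h4 : Real.exp W ≤ Real.exp (U + W) := Real.exp_le_exp.mpr (by linarith only [hU0])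
    have h5 : Real.exp U + Real.exp W ≤ Real.exp (U + W + 1) := by
      rw [Real.exp_add _ 1]
      have he : (2 : ℝ) ≤ Real.exp 1 := by
        have := Real.add_one_le_exp (1 : ℝ); linarith only [this]
      nlinarith only [Real.exp_pos (U + W), he, h3, h4]
    linarith only [h1, h2, h5]
  rw [Real.exp_lt_exp] at hAm
  -- `U + W + 1 ≤ c · A^40`
  have hP1 : (1 : ℝ) ≤ (A : ℝ) ^ 40 := one_le_pow₀ hA1
  have hPA : (A : ℝ) ≤ (A : ℝ) ^ 40 := le_self_pow₀ hA1 (by norm_num)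
  have hPA2 : (A : ℝ) ^ 2 ≤ (A : ℝ) ^ 40 := pow_le_pow_right₀ hA1 (by norm_num)
  have hPA8 : (A : ℝ) ^ 8 ≤ (A : ℝ) ^ 40 := pow_le_pow_right₀ hA1 (by norm_num)
  have hUle : U ≤ (2 * D + Kl + Real.log L + D * R₁) * (A : ℝ) ^ 40 := by
    rw [hU]
    have t1 : (D : ℝ) * A ≤ D * (A : ℝ) ^ 40 := mul_le_mul_of_nonneg_left hPA hD0
    have t2 : Kl ≤ Kl * (A : ℝ) ^ 40 := le_mul_of_one_le_right hKl hP1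
    have t3 : (A : ℝ) * Real.log L ≤ Real.log L * (A : ℝ) ^ 40 := by
      rw [mul_comm]; exact mul_le_mul_of_nonneg_left hPA hlogL
    have t4 : (D : ℝ) * (A : ℝ) ^ 2 ≤ D * (A : ℝ) ^ 40 := mul_le_mul_of_nonneg_left hPA2 hD0
    have t5 : (D : ℝ) * R₁ * A ≤ D * R₁ * (A : ℝ) ^ 40 := mul_le_mul_of_nonneg_left hPA (by positivity)
    linarith only [t1, t2, t3, t4, t5]
  have hWle : W ≤ (kappa1 * D₁ ^ 40 + 1 + D₁ ^ 2 + Real.log L + D) * (A : ℝ) ^ 40 := by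
    rw [hW]
    have t1 : kappa1 * ((D₁ * A) ^ 40) = kappa1 * D₁ ^ 40 * (A : ℝ) ^ 40 := by
      rw [mul_pow]; ring
    have t2 : ((A : ℝ) + D) * ((A : ℝ) + D) ≤ D₁ ^ 2 * (A : ℝ) ^ 40 := by
      have h1 : (A : ℝ) + D ≤ D₁ * A := by rw [hD₁]; nlinarith only [hA1, hD0]
      have h2 : ((A : ℝ) + D) * ((A : ℝ) + D) ≤ (D₁ * A) * (D₁ * A) :=
        mul_le_mul h1 h1 (by positivity) (by positivity)
      have h3 : (D₁ * A) * (D₁ * A) = D₁ ^ 2 * (A : ℝ) ^ 2 := by ring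
      rw [h3] at h2
      exact h2.trans (mul_le_mul_of_nonneg_left hPA2 (by positivity))
    have t3 : (A : ℝ) * Real.log L ≤ Real.log L * (A : ℝ) ^ 40 := by
      rw [mul_comm]; exact mul_le_mul_of_nonneg_left hPA hlogL
    have t4 : (D : ℝ) * A ≤ D * (A : ℝ) ^ 40 := mul_le_mul_of_nonneg_left hPA hD0
    rw [t1]
    linarith only [t2, t3, t4, hPA8]
  have hfinal : (A : ℝ) ^ m < c * (A : ℝ) ^ 40 := by
    have h : U + W + 1 ≤ c * (A : ℝ) ^ 40 := by
      rw [hc]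
      linarith only [hUle, hWle, hP1]
    exact hAm.trans_le h
  exact absurd hfinal (not_lt.mpr (endgame₄₀ hk hb2 (by omega)).le)

end Engine

end Summit.Schanuel.Schanuel.Theorems.RootDecomp1BResFrame

end
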